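import Literature.MathematicalPhysics.QuantumFieldTheory.Balaban1983to89.StrongCouplingKernelWindow
import HarnessLib

/-!
# Venture YMGap, track ROBUST-BALL — the robust one-link Kantorovich–Rubinstein lemma

HONEST FRAMING. WHAT THIS IS: a venture file (cell `pub-ymgap`, track Y2 ROBUST-BALL, seat rb-p1), the
analytic crux of the robust single-link Dobrushin door (referee test T2): for the PERTURBED one-link law
`ν_{B,V}(dg) ∝ exp(N Re tr(g B) - V(g)) σ_N(dg)` on `SU(N)` — the Wilson one-link law `ν_B` re-weighted
by a bounded measurable one-link perturbation `V` — it bounds the Kantorovich–Rubinstein distance between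
`ν_{B,V}` and `ν_{B',V'}` by
`L · (e^{a} √(c v) ‖B' - B‖_F + e^{a/2} √c · sup|V' - V|)` on `L`-Lipschitz test functions, where
`c` is a one-link Poincaré (Lipschitz-variance) constant and `v` a variance constant for the linear
observables of the UNPERTURBED family on the operator-norm ball containing `B, B'`, and `a` bounds the
oscillations of `V, V'`. The first summand is the Wilson half degraded by the Holley–Stroock factor
`e^{a}` (variance form: the density ratio of the re-weighting is `≤ e^{osc}`; NOT `e^{2a}`, no Dirichlet
form is re-weighted), the second is the CROSS half (the new dependence of the law through `V`), with
`Var(V' - V) ≤ sup|V' - V|²`. WHAT THIS IS NOT: no lattice statement (the lattice bookkeeping —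
staple fields, loads of the potential, row sums — is the door file), no number, no claim about any
certificate; pure one-link measure theory on `SU(N)`. Strong-coupling lattice context only; no
continuum / Millennium claim.

## Contents

* `variance_tilted_le_exp_mul_variance` — HOLLEY–STROOCK IN VARIANCE FORM: for a probability measure
  `μ` and a measurable `U` with `lo ≤ U ≤ hi`, `Var_{μ.tilted U}(ψ) ≤ e^{hi - lo} Var_μ(ψ)` for bounded
  measurable `ψ` (centre at the `μ`-mean, bound the density `e^{U}/Z ≤ e^{hi - lo}`).
* `variance_le_sq_of_abs_le` — `Var(w) ≤ D²` if `|w| ≤ D`.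
* `abs_integral_perturbedOneLink_sub_le` — THE ROBUST ONE-LINK LEMMA (statement above), from the
  tree's covariance form of the tilt interpolation (`abs_integral_tilted_add_sub_le_of_cov`) along
  `(B_t, V_t) = (B + t(B' - B), V + t(V' - V))` — the op-norm ball is convex and `osc V_t ≤ a` — with
  Cauchy–Schwarz (`abs_integral_mul_sub_le_of_variance_le`) and the two lemmas above.

## References

* R. Holley, D. Stroock, J. Stat. Phys. 46 (1987) 1159 (bounded perturbations of log-Sobolev /
  Poincaré inequalities; here only the elementary variance form is used).
* H. Föllmer, LNM 1362 (1988), Ch. I, Thm. (2.13), (2.20) (Vasserstein form of Dobrushin's condition).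
* The tree: `LatticeGaugeDobrushinPoincare.lean` (`abs_integral_tilted_add_sub_le`,
  `abs_integral_mul_sub_le_of_variance_le`), `Balaban1983to89/StrongCouplingKernelWindow.lean`
  (`abs_integral_tilted_add_sub_le_of_cov`, `integral_sub_avg_sq_le`),
  `Summits/QuantumFields/BalabanUV/InfraRed/StrongCouplingPoincareDoorSUN.lean`
  (`oneLinkKRModulus_of_poincare_of_varianceBound`, the unperturbed template).
-/

noncomputable section

open MeasureTheory ProbabilityTheory Real
open Literature.MathematicalPhysics.QuantumFieldTheory
open Literature.MathematicalPhysics.QuantumFieldTheory.Balaban1983to89.StrongCouplingKernelWindow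
  (abs_integral_tilted_add_sub_le_of_cov integral_sub_avg_sq_le)

namespace Summit.Ventures.YMGap.RobustBall

/-! ### Holley–Stroock in variance form, and the variance of a bounded observable -/

section General

variable {S : Type*} [MeasurableSpace S]

/-- On a probability space the variance is the least mean-square deviation from a constant:
`∫ (ψ - ∫ψ)² dμ ≤ ∫ (ψ - m)² dμ` for every `m` (bounded measurable `ψ`). [folklore] -/
theorem integral_sub_avg_sq_le_integral_sub_const_sq {μ : Measure S} [IsProbabilityMeasure μ]
    {ψ : S → ℝ} (hψm : Measurable ψ) (hψb : ∃ C, ∀ s, |ψ s| ≤ C) (m : ℝ) :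
    ∫ s, (ψ s - ∫ s', ψ s' ∂μ) ^ 2 ∂μ ≤ ∫ s, (ψ s - m) ^ 2 ∂μ := by
  obtain ⟨C, hC⟩ := hψb
  have hψi : Integrable ψ μ := integrable_of_measurable_of_abs_le hψm hC
  have hX := integral_sub_avg_sq_le (μ := μ) (X := fun s => ψ s - m) (hψm.sub_const m)
    ⟨C + |m|, fun s => (abs_sub _ _).trans (add_le_add (hC s) le_rfl)⟩
  have hmean : ∫ s', (ψ s' - m) ∂μ = (∫ s', ψ s' ∂μ) - m := by
    rw [integral_sub hψi (integrable_const m), integral_const, probReal_univ, one_smul]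
  have hpt : (fun s => (ψ s - m - ∫ s', (ψ s' - m) ∂μ) ^ 2) = fun s => (ψ s - ∫ s', ψ s' ∂μ) ^ 2 := by
    funext s; rw [hmean]; ring
  rw [hpt] at hX
  exact hX

/-- **Holley–Stroock perturbation in VARIANCE form.** Let `μ` be a probability measure and `U` a
measurable function with `lo ≤ U ≤ hi`. Then for every bounded measurable `ψ`,
`Var_{μ.tilted U}(ψ) ≤ e^{hi - lo} · Var_μ(ψ)`: centre `ψ` at its `μ`-mean (the variance is the
least mean-square deviation from a constant) and bound the density `e^{U}/∫e^{U} dμ ≤ e^{hi}/e^{lo}`.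
This is the form in which a one-link Lipschitz-VARIANCE bound transfers to the re-weighted one-link
law with the factor `e^{osc U}` (Holley–Stroock 1987; the Dirichlet-form version would cost
`e^{2 osc U}` and is not used). -/
theorem variance_tilted_le_exp_mul_variance {μ : Measure S} [IsProbabilityMeasure μ] {U ψ : S → ℝ}
    (hUm : Measurable U) {lo hi : ℝ} (hU : ∀ s, lo ≤ U s ∧ U s ≤ hi) (hψm : Measurable ψ)
    (hψb : ∃ C, ∀ s, |ψ s| ≤ C) :
    Var[ψ; μ.tilted U] ≤ exp (hi - lo) * Var[ψ; μ] := by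
  obtain ⟨C, hC⟩ := hψb
  -- the tilted measure is a probability measure
  have hexp : Integrable (fun s => exp (U s)) μ :=
    integrable_of_measurable_of_abs_le hUm.exp (C := exp hi) fun s => by
      rw [abs_of_nonneg (exp_pos _).le]; exact exp_le_exp.2 (hU s).2
  haveI : IsProbabilityMeasure (μ.tilted U) := isProbabilityMeasure_tilted hexp
  set m₀ : ℝ := ∫ s, ψ s ∂μ with hm₀
  have hFm : Measurable fun s => (ψ s - m₀) ^ 2 := (hψm.sub_const _).pow_const 2
  have hFb : ∀ s, |(ψ s - m₀) ^ 2| ≤ (C + |m₀|) ^ 2 := fun s => by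
    rw [abs_pow]
    exact pow_le_pow_left₀ (abs_nonneg _) ((abs_sub _ _).trans (add_le_add (hC s) le_rfl)) 2
  have hFi : Integrable (fun s => (ψ s - m₀) ^ 2) μ := integrable_of_measurable_of_abs_le hFm hFb
  -- normaliser from below
  have hZ : exp lo ≤ ∫ s, exp (U s) ∂μ := by
    calc exp lo = ∫ _s, exp lo ∂μ := by simp
      _ ≤ ∫ s, exp (U s) ∂μ := integral_mono (integrable_const _) hexp fun s => exp_le_exp.2 (hU s).1
  have hZpos : 0 < ∫ s, exp (U s) ∂μ := (exp_pos lo).trans_le hZ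
  -- density bound
  have hdens : ∀ s, exp (U s) / (∫ x, exp (U x) ∂μ) ≤ exp (hi - lo) := fun s => by
    rw [div_le_iff₀ hZpos, exp_sub, div_mul_eq_mul_div, le_div_iff₀ (exp_pos lo)]
    exact mul_le_mul (exp_le_exp.2 (hU s).2) hZ (exp_pos lo).le (exp_pos hi).le
  rw [variance_eq_integral hψm.aemeasurable, variance_eq_integral hψm.aemeasurable]
  calc ∫ s, (ψ s - ∫ s', ψ s' ∂μ.tilted U) ^ 2 ∂μ.tilted U
      ≤ ∫ s, (ψ s - m₀) ^ 2 ∂μ.tilted U :=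
        integral_sub_avg_sq_le_integral_sub_const_sq hψm ⟨C, hC⟩ m₀
    _ = ∫ s, exp (U s) / (∫ x, exp (U x) ∂μ) * (ψ s - m₀) ^ 2 ∂μ := by
        rw [integral_tilted]; rfl
    _ ≤ ∫ s, exp (hi - lo) * (ψ s - m₀) ^ 2 ∂μ := by
        refine integral_mono ?_ (hFi.const_mul _) fun s =>
          mul_le_mul_of_nonneg_right (hdens s) (sq_nonneg _)
        refine integrable_of_measurable_of_abs_le ((hUm.exp.div_const _).mul hFm)
          (C := exp (hi - lo) * (C + |m₀|) ^ 2) fun s => ?_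
        rw [abs_mul, abs_of_nonneg (div_nonneg (exp_pos _).le hZpos.le)]
        exact mul_le_mul (hdens s) (hFb s) (abs_nonneg _) (exp_pos _).le
    _ = exp (hi - lo) * ∫ s, (ψ s - m₀) ^ 2 ∂μ := integral_const_mul _ _

/-- The variance of an observable bounded by `D` is at most `D²`. [folklore] -/
theorem variance_le_sq_of_abs_le {μ : Measure S} [IsProbabilityMeasure μ] {w : S → ℝ}
    (hwm : Measurable w) {D : ℝ} (hw : ∀ s, |w s| ≤ D) :
    ∫ s, (w s - ∫ s', w s' ∂μ) ^ 2 ∂μ ≤ D ^ 2 / 1 := by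
  rw [div_one]
  calc ∫ s, (w s - ∫ s', w s' ∂μ) ^ 2 ∂μ ≤ ∫ s, w s ^ 2 ∂μ := integral_sub_avg_sq_le hwm ⟨D, hw⟩
    _ ≤ ∫ _s, D ^ 2 ∂μ := by
        refine integral_mono ?_ (integrable_const _) fun s => ?_
        · exact integrable_of_measurable_of_abs_le (hwm.pow_const 2) (C := D ^ 2) fun s => by
            rw [abs_pow]; exact pow_le_pow_left₀ (abs_nonneg _) (hw s) 2
        · calc w s ^ 2 = |w s| ^ 2 := (sq_abs _).symm
            _ ≤ D ^ 2 := pow_le_pow_left₀ (abs_nonneg _) (hw s) 2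
    _ = D ^ 2 := by simp

end General

/-! ### The robust one-link lemma on `SU(N)` -/

section SUN

variable {N : ℕ}

/-- **The robust one-link Kantorovich–Rubinstein lemma** (referee test T2, both halves). Let `σ_N`
be the Haar probability measure on `SU(N)`, `ν_B = σ_N.tilted (g ↦ N Re tr(g B))` the Wilson one-link
family, and suppose on the operator-norm ball `‖B‖_op ≤ b`:
(P) `Var_{ν_B}(ψ) ≤ c M²` for every `M`-Lipschitz `ψ` (Frobenius distance) — a one-link Poincaré
constant in Lipschitz-variance form (the cell's `OneLinkPoincareBound N b k` is `c = 1/(N k)`;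
`SU(2)`: `c = 2/3` for every `b`, tree `oneLinkPoincareSU2_sharp`);
(V) `Var_{ν_B}(N Re tr(g Δ)) ≤ v ‖Δ‖_F²` for every direction `Δ` (always true with `v = c N²`).
Let `B, B'` lie in the ball, let `V, V'` be measurable one-link perturbations with oscillation windows
`lo ≤ V ≤ lo + a`, `lo' ≤ V' ≤ lo' + a`, and `|V' - V| ≤ D` pointwise. Then for every bounded
measurable `L`-Lipschitz `φ`,
`|∫ φ dν_{B',V'} - ∫ φ dν_{B,V}| ≤ L (e^{a} √(c v) ‖B' - B‖_F + e^{a/2} √c D)`,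
where `ν_{B,V} = σ_N.tilted (g ↦ N Re tr(g B) - V g)` is the PERTURBED one-link law
(`siteLaw_perturbedYM_thooft`). Proof: covariance form of the tilt interpolation along
`(B_t, V_t) = (B + t(B'-B), V + t(V'-V))`; each interpolated law is `ν_{B_t}` re-weighted by `-V_t`,
`osc V_t ≤ a`, so by Holley–Stroock (variance form) `Var_t(φ) ≤ e^{a} c L²`,
`Var_t(N Re tr(g(B'-B))) ≤ e^{a} v ‖B'-B‖_F²`, while `Var_t(V'-V) ≤ D²`; Cauchy–Schwarz. -/
theorem abs_integral_perturbedOneLink_sub_le {b c v a D L lo lo' : ℝ} (hc : 0 ≤ c) (hv : 0 ≤ v)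
    (hD : 0 ≤ D) (hL : 0 ≤ L)
    (hP : ∀ B : Matrix (Fin N) (Fin N) ℂ, matrixOpNorm B ≤ b →
      ∀ (ψ : Matrix.specialUnitaryGroup (Fin N) ℂ → ℝ) (M : ℝ), 0 ≤ M →
        (∀ x y, |ψ x - ψ y| ≤ M * suFrobDist x y) →
        Var[ψ; (haarProbability (Matrix.specialUnitaryGroup (Fin N) ℂ)).tilted
          fun g => (N : ℝ) * ((g : Matrix (Fin N) (Fin N) ℂ) * B).trace.re] ≤ c * M ^ 2)
    (hVB : ∀ B : Matrix (Fin N) (Fin N) ℂ, matrixOpNorm B ≤ b → ∀ Δ : Matrix (Fin N) (Fin N) ℂ,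
      Var[fun g : Matrix.specialUnitaryGroup (Fin N) ℂ =>
          (N : ℝ) * ((g : Matrix (Fin N) (Fin N) ℂ) * Δ).trace.re;
        (haarProbability (Matrix.specialUnitaryGroup (Fin N) ℂ)).tilted
          fun g => (N : ℝ) * ((g : Matrix (Fin N) (Fin N) ℂ) * B).trace.re] ≤ v * frobNorm Δ ^ 2)
    {B B' : Matrix (Fin N) (Fin N) ℂ} (hB : matrixOpNorm B ≤ b) (hB' : matrixOpNorm B' ≤ b)
    {V V' : Matrix.specialUnitaryGroup (Fin N) ℂ → ℝ} (hVm : Measurable V) (hV'm : Measurable V')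
    (hVlo : ∀ g, lo ≤ V g ∧ V g ≤ lo + a) (hV'lo : ∀ g, lo' ≤ V' g ∧ V' g ≤ lo' + a)
    (hVV' : ∀ g, |V' g - V g| ≤ D)
    {φ : Matrix.specialUnitaryGroup (Fin N) ℂ → ℝ} (hφm : Measurable φ) (hφb : ∃ C, ∀ s, |φ s| ≤ C)
    (hφL : ∀ x y, |φ x - φ y| ≤ L * suFrobDist x y) :
    |∫ s, φ s ∂((haarProbability (Matrix.specialUnitaryGroup (Fin N) ℂ)).tilted
          fun g => (N : ℝ) * ((g : Matrix (Fin N) (Fin N) ℂ) * B').trace.re - V' g) -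
        ∫ s, φ s ∂((haarProbability (Matrix.specialUnitaryGroup (Fin N) ℂ)).tilted
          fun g => (N : ℝ) * ((g : Matrix (Fin N) (Fin N) ℂ) * B).trace.re - V g)| ≤
      L * (exp a * Real.sqrt (c * v) * frobNorm (B' - B) + exp (a / 2) * Real.sqrt c * D) := by
  classical
  set σ : Measure (Matrix.specialUnitaryGroup (Fin N) ℂ) :=
    haarProbability (Matrix.specialUnitaryGroup (Fin N) ℂ) with hσ
  -- the linear tilt `lin M g = N Re tr(g M)`
  set lin : Matrix (Fin N) (Fin N) ℂ → Matrix.specialUnitaryGroup (Fin N) ℂ → ℝ :=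
    fun M g => (N : ℝ) * ((g : Matrix (Fin N) (Fin N) ℂ) * M).trace.re with hlin
  have hN0 : (0 : ℝ) ≤ N := Nat.cast_nonneg N
  have ha0 : 0 ≤ a := by
    rcases isEmpty_or_nonempty (Matrix.specialUnitaryGroup (Fin N) ℂ) with h | ⟨⟨g⟩⟩
    · exact (not_isEmpty_of_nonempty (Matrix.specialUnitaryGroup (Fin N) ℂ) h).elim
    · have := hVlo g; linarith
  -- the potentials `f` (at `(B, V)`) and the direction `w = w₁ - w₂`
  set f : Matrix.specialUnitaryGroup (Fin N) ℂ → ℝ := fun g => lin B g - V g with hf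
  set w₁ : Matrix.specialUnitaryGroup (Fin N) ℂ → ℝ := fun g => lin (B' - B) g with hw₁
  set w₂ : Matrix.specialUnitaryGroup (Fin N) ℂ → ℝ := fun g => V' g - V g with hw₂
  set w : Matrix.specialUnitaryGroup (Fin N) ℂ → ℝ := fun g => w₁ g - w₂ g with hw
  have hlin_m : ∀ M : Matrix (Fin N) (Fin N) ℂ, Measurable (lin M) := fun M =>
    (continuous_const.mul (continuous_re_trace_su_mul M)).measurable
  have hlin_b : ∀ (M : Matrix (Fin N) (Fin N) ℂ) (s : Matrix.specialUnitaryGroup (Fin N) ℂ),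
      |lin M s| ≤ (N : ℝ) * (Real.sqrt N * frobNorm M) := fun M s => by
    simp only [hlin]
    rw [abs_mul, abs_of_nonneg hN0]
    exact mul_le_mul_of_nonneg_left (abs_re_trace_su_mul_le s M) hN0
  have hlin_lip : ∀ (M : Matrix (Fin N) (Fin N) ℂ) (x y : Matrix.specialUnitaryGroup (Fin N) ℂ),
      |lin M x - lin M y| ≤ (N : ℝ) * frobNorm M * suFrobDist x y := fun M x y => by
    simp only [hlin]
    rw [← mul_sub, abs_mul, abs_of_nonneg hN0, mul_assoc]
    refine mul_le_mul_of_nonneg_left ?_ hN0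
    rw [mul_comm]
    exact abs_re_trace_su_mul_sub_le x y M
  -- bounds on `V`, `V'`
  have hVb : ∀ g, |V g| ≤ |lo| + a := fun g => by
    have := hVlo g; rw [abs_le]; constructor <;> [linarith [neg_abs_le lo]; linarith [le_abs_self lo]]
  have hV'b : ∀ g, |V' g| ≤ |lo'| + a := fun g => by
    have := hV'lo g; rw [abs_le]; constructor <;> [linarith [neg_abs_le lo']; linarith [le_abs_self lo']]
  have hfm : Measurable f := (hlin_m B).sub hVm
  have hfb : ∃ C, ∀ s, |f s| ≤ C :=
    ⟨(N : ℝ) * (Real.sqrt N * frobNorm B) + (|lo| + a), fun s =>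
      (abs_sub _ _).trans (add_le_add (hlin_b B s) (hVb s))⟩
  have hw₁m : Measurable w₁ := hlin_m _
  have hw₂m : Measurable w₂ := hV'm.sub hVm
  have hwm : Measurable w := hw₁m.sub hw₂m
  have hwB : ∀ s, |w s| ≤ (N : ℝ) * (Real.sqrt N * frobNorm (B' - B)) + D := fun s =>
    (abs_sub _ _).trans (add_le_add (hlin_b _ s) (hVV' s))
  -- identify the two endpoint laws with `σ.tilted (f + w)` and `σ.tilted f`
  have hend : (fun g : Matrix.specialUnitaryGroup (Fin N) ℂ => lin B' g - V' g) = fun g => f g + w g := by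
    funext g
    simp only [hf, hw, hw₁, hw₂, hlin, Matrix.mul_sub, Matrix.trace_sub, Complex.sub_re]
    ring
  have key := abs_integral_tilted_add_sub_le_of_cov (μ := σ)
    (A := L * (exp a * Real.sqrt (c * v) * frobNorm (B' - B) + exp (a / 2) * Real.sqrt c * D))
    hfm hfb hwm hwB hφm hφb ?_
  · change |∫ s, φ s ∂σ.tilted (fun g => lin B' g - V' g) - ∫ s, φ s ∂σ.tilted f| ≤ _
    rw [hend]
    exact key
  -- the covariance bound along the interpolation
  intro t ht
  -- the interpolated tilt is `ν_{B_t}` re-weighted by `-V_t`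
  set Bt : Matrix (Fin N) (Fin N) ℂ := B + (t : ℂ) • (B' - B) with hBt
  set Vt : Matrix.specialUnitaryGroup (Fin N) ℂ → ℝ := fun g => V g + t * (V' g - V g) with hVt
  have hft : (fun u : Matrix.specialUnitaryGroup (Fin N) ℂ => f u + t * w u) =
      fun g => lin Bt g + -Vt g := by
    funext g
    simp only [hf, hw, hw₁, hw₂, hVt, hBt, hlin, Matrix.mul_add, Matrix.mul_smul, Matrix.mul_sub,
      Matrix.trace_add, Matrix.trace_smul, Matrix.trace_sub, Complex.add_re, Complex.sub_re,
      smul_eq_mul, Complex.re_ofReal_mul]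
    ring
  have hBt_le : matrixOpNorm Bt ≤ b := by
    have h1 : Bt = ((1 - t : ℝ) : ℂ) • B + ((t : ℝ) : ℂ) • B' := by
      rw [hBt]; push_cast; simp only [smul_sub, sub_smul, one_smul]; abel
    rw [h1]
    calc matrixOpNorm (((1 - t : ℝ) : ℂ) • B + ((t : ℝ) : ℂ) • B')
        ≤ matrixOpNorm (((1 - t : ℝ) : ℂ) • B) + matrixOpNorm (((t : ℝ) : ℂ) • B') := matrixOpNorm_add_le _ _
      _ = (1 - t) * matrixOpNorm B + t * matrixOpNorm B' := by
          rw [matrixOpNorm_smul, matrixOpNorm_smul, Complex.norm_real, Complex.norm_real, Real.norm_eq_abs,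
            Real.norm_eq_abs, abs_of_nonneg (by linarith [ht.2]), abs_of_nonneg ht.1]
      _ ≤ (1 - t) * b + t * b :=
          add_le_add (mul_le_mul_of_nonneg_left hB (by linarith [ht.2])) (mul_le_mul_of_nonneg_left hB' ht.1)
      _ = b := by ring
  -- oscillation window of `V_t`
  have hVt_lo : ∀ g, (1 - t) * lo + t * lo' ≤ Vt g ∧ Vt g ≤ (1 - t) * lo + t * lo' + a := fun g => by
    have h1 := hVlo g; have h2 := hV'lo g
    have ht0 := ht.1; have ht1 : 0 ≤ 1 - t := by linarith [ht.2]
    simp only [hVt]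
    constructor <;> nlinarith
  have hVtm : Measurable Vt := hVm.add ((hV'm.sub hVm).const_mul t)
  -- the unperturbed law at `B_t` and the re-weighted law
  set νt : Measure (Matrix.specialUnitaryGroup (Fin N) ℂ) := σ.tilted (lin Bt) with hνt
  have hexpBt : Integrable (fun s => exp (lin Bt s)) σ :=
    integrable_of_measurable_of_abs_le (hlin_m Bt).exp (C := exp ((N : ℝ) * (Real.sqrt N * frobNorm Bt)))
      fun s => by rw [abs_of_nonneg (exp_pos _).le]; exact exp_le_exp.2 ((le_abs_self _).trans (hlin_b Bt s))
  haveI : IsProbabilityMeasure νt := isProbabilityMeasure_tilted hexpBt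
  have hreweight : σ.tilted (fun g => lin Bt g + -Vt g) = νt.tilted (fun g => -Vt g) := by
    rw [hνt, tilted_tilted hexpBt]; rfl
  have hexpVt : Integrable (fun s => exp (-Vt s)) νt :=
    integrable_of_measurable_of_abs_le hVtm.neg.exp (C := exp (-((1 - t) * lo + t * lo')))
      fun s => by rw [abs_of_nonneg (exp_pos _).le]; exact exp_le_exp.2 (neg_le_neg (hVt_lo s).1)
  haveI : IsProbabilityMeasure (νt.tilted fun g => -Vt g) := isProbabilityMeasure_tilted hexpVt
  -- Holley–Stroock transfer of the two variance bounds
  have hwin : ∀ g, -((1 - t) * lo + t * lo' + a) ≤ -Vt g ∧ -Vt g ≤ -((1 - t) * lo + t * lo') :=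
    fun g => ⟨neg_le_neg (hVt_lo g).2, neg_le_neg (hVt_lo g).1⟩
  have hfac : -((1 - t) * lo + t * lo') - -((1 - t) * lo + t * lo' + a) = a := by ring
  have hVφ : Var[φ; νt.tilted fun g => -Vt g] ≤ exp a * (c * L ^ 2) := by
    have h := variance_tilted_le_exp_mul_variance (μ := νt) hVtm.neg hwin hφm hφb
    rw [hfac] at h
    exact h.trans (mul_le_mul_of_nonneg_left (hP Bt hBt_le φ L hL hφL) (exp_pos a).le)
  have hVw₁ : Var[w₁; νt.tilted fun g => -Vt g] ≤ exp a * (v * frobNorm (B' - B) ^ 2) := by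
    have h := variance_tilted_le_exp_mul_variance (μ := νt) hVtm.neg hwin hw₁m ⟨_, hlin_b (B' - B)⟩
    rw [hfac] at h
    exact h.trans (mul_le_mul_of_nonneg_left (hVB Bt hBt_le (B' - B)) (exp_pos a).le)
  -- Cauchy–Schwarz for the two halves
  rw [hft, hreweight]
  set μt := νt.tilted fun g => -Vt g with hμt
  have hφi : Integrable φ μt := by
    obtain ⟨C, hC⟩ := hφb; exact integrable_of_measurable_of_abs_le hφm hC
  have hw₁i : Integrable w₁ μt := integrable_of_measurable_of_abs_le hw₁m (hlin_b (B' - B))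
  have hw₂i : Integrable w₂ μt := integrable_of_measurable_of_abs_le hw₂m hVV'
  obtain ⟨Cφ, hCφ⟩ := hφb
  have hφw₁i : Integrable (fun s => φ s * w₁ s) μt :=
    integrable_of_measurable_of_abs_le (hφm.mul hw₁m) (C := Cφ * ((N : ℝ) * (Real.sqrt N * frobNorm (B' - B))))
      fun s => by rw [abs_mul]; exact mul_le_mul (hCφ s) (hlin_b _ s) (abs_nonneg _) ((abs_nonneg _).trans (hCφ s))
  have hφw₂i : Integrable (fun s => φ s * w₂ s) μt :=
    integrable_of_measurable_of_abs_le (hφm.mul hw₂m) (C := Cφ * D)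
      fun s => by rw [abs_mul]; exact mul_le_mul (hCφ s) (hVV' s) (abs_nonneg _) ((abs_nonneg _).trans (hCφ s))
  -- split the covariance
  have hsplit : ∫ s, φ s * w s ∂μt - (∫ s, φ s ∂μt) * ∫ s, w s ∂μt =
      (∫ s, φ s * w₁ s ∂μt - (∫ s, φ s ∂μt) * ∫ s, w₁ s ∂μt) -
        (∫ s, φ s * w₂ s ∂μt - (∫ s, φ s ∂μt) * ∫ s, w₂ s ∂μt) := by
    have e1 : (fun s => φ s * w s) = fun s => φ s * w₁ s - φ s * w₂ s := by funext s; simp only [hw]; ring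
    rw [e1, integral_sub hφw₁i hφw₂i, show (fun s => w s) = fun s => w₁ s - w₂ s from rfl,
      integral_sub hw₁i hw₂i]
    ring
  -- variance of the test function in integral form
  have hVφ' : ∫ s, (φ s - ∫ s', φ s' ∂μt) ^ 2 ∂μt ≤ (Real.sqrt (exp a * c) * L) ^ 2 / 1 := by
    rw [← variance_eq_integral hφm.aemeasurable, div_one, mul_pow,
      Real.sq_sqrt (mul_nonneg (exp_pos a).le hc)]
    calc Var[φ; μt] ≤ exp a * (c * L ^ 2) := hVφ
      _ = exp a * c * L ^ 2 := by ring
  have hVw₁' : ∫ s, (w₁ s - ∫ s', w₁ s' ∂μt) ^ 2 ∂μt ≤ (Real.sqrt (exp a * v) * frobNorm (B' - B)) ^ 2 / 1 := by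
    rw [← variance_eq_integral hw₁m.aemeasurable, div_one, mul_pow,
      Real.sq_sqrt (mul_nonneg (exp_pos a).le hv)]
    calc Var[w₁; μt] ≤ exp a * (v * frobNorm (B' - B) ^ 2) := hVw₁
      _ = exp a * v * frobNorm (B' - B) ^ 2 := by ring
  have hVw₂' : ∫ s, (w₂ s - ∫ s', w₂ s' ∂μt) ^ 2 ∂μt ≤ D ^ 2 / 1 := variance_le_sq_of_abs_le hw₂m hVV'
  have hcov₁ := abs_integral_mul_sub_le_of_variance_le (ν := μt)
    (L := Real.sqrt (exp a * c) * L) (M := Real.sqrt (exp a * v) * frobNorm (B' - B)) one_pos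
    (mul_nonneg (Real.sqrt_nonneg _) hL) (mul_nonneg (Real.sqrt_nonneg _) (frobNorm_nonneg _))
    hφm ⟨Cφ, hCφ⟩ hw₁m ⟨_, hlin_b (B' - B)⟩ hVφ' hVw₁'
  have hcov₂ := abs_integral_mul_sub_le_of_variance_le (ν := μt)
    (L := Real.sqrt (exp a * c) * L) (M := D) one_pos (mul_nonneg (Real.sqrt_nonneg _) hL) hD
    hφm ⟨Cφ, hCφ⟩ hw₂m ⟨D, hVV'⟩ hVφ' hVw₂'
  rw [hsplit]
  refine (abs_sub _ _).trans ((add_le_add hcov₁ hcov₂).trans (le_of_eq ?_))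
  -- arithmetic of the constants
  have hsq1 : Real.sqrt (exp a * c) * Real.sqrt (exp a * v) = exp a * Real.sqrt (c * v) := by
    rw [← Real.sqrt_mul (by positivity), show exp a * c * (exp a * v) = (exp a) ^ 2 * (c * v) by ring,
      Real.sqrt_mul (by positivity), Real.sqrt_sq (exp_pos a).le]
  have hsq2 : Real.sqrt (exp a * c) = exp (a / 2) * Real.sqrt c := by
    have he : exp a = exp (a / 2) ^ 2 := by rw [sq, ← exp_add, add_halves]
    rw [Real.sqrt_mul (exp_pos a).le, he, Real.sqrt_sq (exp_pos _).le]
  rw [div_one, div_one]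
  calc Real.sqrt (exp a * c) * L * (Real.sqrt (exp a * v) * frobNorm (B' - B)) +
        Real.sqrt (exp a * c) * L * D
      = L * (Real.sqrt (exp a * c) * Real.sqrt (exp a * v) * frobNorm (B' - B) +
          Real.sqrt (exp a * c) * D) := by ring
    _ = L * (exp a * Real.sqrt (c * v) * frobNorm (B' - B) + exp (a / 2) * Real.sqrt c * D) := by
        rw [hsq1, hsq2]

end SUN

end Summit.Ventures.YMGap.RobustBall
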